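import Summits.Ventures.HodgeRepro2.T5FinitePlaceSplitConj
import Summits.Ventures.HodgeRepro2.T5SplitHermitianClass
import Summits.Ventures.HodgeRepro2.T5HermitianDetClass

/-!
# Row N2.2.2's SPLIT case on the route's own objects: over `K⁺_v ⊗ K` with the conjugation `1 ⊗ c`, every
invertible hermitian matrix is congruent to `1` when `v` splits (cell pub-hodge-repro2, seat p3)

Tier-5 N2 support, row N2.2.2 of route/T5-N2-route-3.md («one class per dimension at a split place», Shimura §1.8
(S-7)). File 131 proved it abstractly over `(F × F, swap)`; files 127 / 130 identified `K⁺_v ⊗_{K⁺} K` with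
`K_w × K_{w'}` at a split place `v` (`w ≠ w'` above `v`, `c • w = w'`) and showed that `1 ⊗ c` becomes the swap
composed with the Galois transports. This file puts the two together on the route's local algebra:

* `isHermitian_map_of_star_comm` / `isUnit_det_map` / `isCongruent_map_of_star_comm`: hermitian matrices, unit determinants and
  congruence transport along a star-compatible ring homomorphism (generic);
* `tensorStarRing`: `K⁺_v ⊗ K` as a star ring with `star = conjTensor = 1 ⊗ c` (an involution);
* `transport_conj_transport_conj`: the two transports `K_w → K_{w'} → K_w` by `c` compose to the identity;
* `splitEquiv : K⁺_v ⊗ K ≃+* K_w × K_w` (`prodLiftEquiv` followed by the transport on the second factor), with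
  `splitEquiv_star`: it carries `1 ⊗ c` to the swap;
* **`exists_isCongruent_one`**: at a split place every hermitian matrix over `K⁺_v ⊗ K` with unit determinant is
  congruent to `1`; `isCongruent_of_isHermitian`: any two are congruent — ONE CLASS PER DIMENSION on the route's
  own objects (files 131–132 are the abstract statement, this is its instantiation).

Mathlib + this seat's files 127, 129, 130, 131, 134 only; no display; no device. §8(d): uses an L-value-free
non-vanishing device: NO.
-/

namespace Summit.Ventures.HodgeRepro2.T5FinitePlaceSplitClassification

open IsDedekindDomain IsDedekindDomain.HeightOneSpectrum NumberField NumberField.IsCMField Module Matrix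
open scoped TensorProduct Pointwise Summit.Ventures.HodgeRepro2.T5FinitePlaceLiesOver
open Summit.Ventures.HodgeRepro2.T5FinitePlaceLiesOver Summit.Ventures.HodgeRepro2.T5FinitePlaceSplitProduct
  Summit.Ventures.HodgeRepro2.T5FinitePlaceSplitConj Summit.Ventures.HodgeRepro2.T5FinitePlaceGaloisTransport
  Summit.Ventures.HodgeRepro2.T5SplitHermitianClass Summit.Ventures.HodgeRepro2.T5HermitianDetClass

section Transport

variable {R S : Type*} [CommRing R] [CommRing S] [StarRing R] [StarRing S] {n : Type*} [Fintype n]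
  [DecidableEq n] (f : R →+* S) (hf : ∀ x, f (star x) = star (f x))

omit [Fintype n] [DecidableEq n] in
include hf in
/-- A star-compatible ring homomorphism carries hermitian matrices to hermitian matrices. -/
theorem isHermitian_map_of_star_comm {H : Matrix n n R} (hH : H.IsHermitian) : (H.map f).IsHermitian := by
  unfold IsHermitian at hH ⊢
  rw [← conjTranspose_map (A := H) (⇑f) hf, hH]

omit [StarRing R] [StarRing S] in
/-- A ring homomorphism carries unit determinants to unit determinants. -/
theorem isUnit_det_map {H : Matrix n n R} (h : IsUnit H.det) : IsUnit (H.map f).det := by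
  have := RingHom.map_det f H
  rw [RingHom.mapMatrix_apply] at this
  rw [← this]
  exact h.map f

include hf in
/-- A star-compatible ring homomorphism carries congruent matrices to congruent matrices. -/
theorem isCongruent_map_of_star_comm {H H' : Matrix n n R} (h : IsCongruent H H') : IsCongruent (H.map f) (H'.map f) := by
  obtain ⟨P, hP, hPH⟩ := h
  refine ⟨P.map f, isUnit_det_map f hP, ?_⟩
  rw [← conjTranspose_map (A := P) (⇑f) hf, ← Matrix.map_mul, ← Matrix.map_mul, hPH]

/-- The inverse of a star-compatible ring isomorphism is star-compatible. -/
theorem symm_star_comm (e : R ≃+* S) (he : ∀ x, e (star x) = star (e x)) (s : S) :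
    e.symm (star s) = star (e.symm s) := by
  apply e.injective
  rw [RingEquiv.apply_symm_apply, he, RingEquiv.apply_symm_apply]

end Transport

section Split

variable (K : Type*) [Field K] [NumberField K] [IsCMField K]
variable (v : HeightOneSpectrum (𝓞 (maximalRealSubfield K))) (w w' : HeightOneSpectrum (𝓞 K))
  [w.asIdeal.LiesOver v.asIdeal] [w'.asIdeal.LiesOver v.asIdeal]
variable (hw : complexConj K • w.asIdeal = w'.asIdeal)

/-- `1 ⊗ c` is an involution of `K⁺_v ⊗ K`. -/
theorem conjTensor_conjTensor (z : (v.adicCompletion (maximalRealSubfield K)) ⊗[maximalRealSubfield K] K) :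
    conjTensor K v (conjTensor K v z) = z := by
  induction z using TensorProduct.induction_on with
  | zero => simp only [map_zero]
  | tmul a x => rw [conjTensor_tmul, conjTensor_tmul, complexConj_apply_apply]
  | add x y hx hy => rw [map_add, map_add, hx, hy]

/-- **`K⁺_v ⊗ K` as a star ring:** `star = 1 ⊗ c`. A definition, not an instance. -/
noncomputable abbrev tensorStarRing :
    StarRing ((v.adicCompletion (maximalRealSubfield K)) ⊗[maximalRealSubfield K] K) where
  star := conjTensor K v
  star_involutive := conjTensor_conjTensor K v
  star_mul x y := by rw [map_mul, mul_comm]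
  star_add x y := map_add _ x y

/-- `star z = conjTensor z`. -/
theorem tensorStar_def (z : (v.adicCompletion (maximalRealSubfield K)) ⊗[maximalRealSubfield K] K) :
    letI := tensorStarRing K v
    star z = conjTensor K v z := rfl

include hw in
/-- The transports `K_w → K_{w'} → K_w` by the conjugation compose to the identity (`c ∘ c = 1`, by density). -/
theorem transport_conj_transport_conj (z : w.adicCompletion K) :
    transport w' w (complexConj K) (complexConj_smul_eq K w w' hw)
      (transport w w' (complexConj K) hw z) = z := by
  have hd : DenseRange (algebraMap K (w.adicCompletion K)) := denseRange_algebraMap (K := K) (v := w)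
  have h1 : Continuous fun y : w.adicCompletion K =>
      transport w' w (complexConj K) (complexConj_smul_eq K w w' hw) (transport w w' (complexConj K) hw y) :=
    (continuous_transport w' w (complexConj K) _).comp (continuous_transport w w' (complexConj K) hw)
  refine congrFun (hd.equalizer h1 continuous_id (funext fun x => ?_)) z
  simp only [Function.comp_apply, id_eq]
  rw [show algebraMap K (w.adicCompletion K) x = (x : w.adicCompletion K) from rfl, transport_coe, transport_coe,
    complexConj_apply_apply]

variable {θ : maximalRealSubfield K} {y : K}
  (hθ : algebraMap (maximalRealSubfield K) K θ = y ^ 2) (hy : complexConj K y ≠ y)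
  (hne : w ≠ w')
  (hsq : IsSquare (algebraMap (maximalRealSubfield K) (v.adicCompletion (maximalRealSubfield K)) θ))

/-- The transport `K_{w'} → K_w` by the conjugation as a ring isomorphism. -/
noncomputable def transportConjEquiv : w'.adicCompletion K ≃+* w.adicCompletion K :=
  RingEquiv.ofBijective (transport w' w (complexConj K) (complexConj_smul_eq K w w' hw))
    (transport_bijective w' w (complexConj K) _)

/-- `transportConjEquiv` unwrapped. -/
theorem transportConjEquiv_apply (z : w'.adicCompletion K) :
    transportConjEquiv K w w' hw z = transport w' w (complexConj K) (complexConj_smul_eq K w w' hw) z := rfl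

/-- **`K⁺_v ⊗ K ≃+* K_w × K_w` at a split place:** `prodLiftEquiv` followed by the transport `K_{w'} → K_w`. -/
noncomputable def splitEquiv :
    ((v.adicCompletion (maximalRealSubfield K)) ⊗[maximalRealSubfield K] K) ≃+*
      (w.adicCompletion K × w.adicCompletion K) :=
  (prodLiftEquiv K v w w' hθ hy hne hsq).toRingEquiv.trans
    (RingEquiv.prodCongr (RingEquiv.refl _) (transportConjEquiv K w w' hw))

/-- `splitEquiv z = ((prodLift z).1, transport (prodLift z).2)`. -/
theorem splitEquiv_apply (z : (v.adicCompletion (maximalRealSubfield K)) ⊗[maximalRealSubfield K] K) :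
    splitEquiv K v w w' hw hθ hy hne hsq z =
      ((prodLift K v w w' z).1,
        transport w' w (complexConj K) (complexConj_smul_eq K w w' hw) (prodLift K v w w' z).2) := rfl

/-- **`splitEquiv` carries `1 ⊗ c` to the swap.** -/
theorem splitEquiv_star (z : (v.adicCompletion (maximalRealSubfield K)) ⊗[maximalRealSubfield K] K) :
    letI := tensorStarRing K v
    letI := swapStarRing (w.adicCompletion K)
    splitEquiv K v w w' hw hθ hy hne hsq (star z) = star (splitEquiv K v w w' hw hθ hy hne hsq z) := by
  letI := tensorStarRing K v
  letI := swapStarRing (w.adicCompletion K)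
  rw [splitEquiv_apply, splitEquiv_apply, swap_star_apply, tensorStar_def, prodLift_conjTensor K v w w' hw,
    transport_conj_transport_conj K w w' hw]

include w w' hw hθ hy hne hsq in
/-- **ONE CLASS PER DIMENSION AT A SPLIT PLACE, on the route's own objects:** every hermitian matrix over
`K⁺_v ⊗ K` (conjugation `1 ⊗ c`) with unit determinant is congruent to `1` when `v` splits in `K`
(`w ≠ w'` above `v`, `c • w = w'`, `θ` a `v`-adic square). -/
theorem exists_isCongruent_one {n : Type*} [Fintype n] [DecidableEq n]
    (H : Matrix n n ((v.adicCompletion (maximalRealSubfield K)) ⊗[maximalRealSubfield K] K))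
    (hH : letI := tensorStarRing K v; H.IsHermitian) (hdet : IsUnit H.det) :
    letI := tensorStarRing K v
    IsCongruent H 1 := by
  letI := tensorStarRing K v
  letI := swapStarRing (w.adicCompletion K)
  set e := splitEquiv K v w w' hw hθ hy hne hsq with he
  have hstar : ∀ z, e (star z) = star (e z) := fun z => splitEquiv_star K v w w' hw hθ hy hne hsq z
  have hstar' : ∀ z, e.toRingHom (star z) = star (e.toRingHom z) := hstar
  have hstar'' : ∀ z, e.symm.toRingHom (star z) = star (e.symm.toRingHom z) := symm_star_comm e hstar
  have hH' : (H.map e.toRingHom).IsHermitian := isHermitian_map_of_star_comm e.toRingHom hstar' hH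
  have hd' : IsUnit (H.map e.toRingHom).det := isUnit_det_map e.toRingHom hdet
  obtain ⟨P, hP, hPH⟩ := exists_conjTranspose_mul_eq_one (H.map e.toRingHom) hH' hd'
  have hc : IsCongruent (H.map e.toRingHom) 1 := ⟨P, hP, hPH⟩
  have hback := isCongruent_map_of_star_comm e.symm.toRingHom hstar'' hc
  have h1 : (H.map e.toRingHom).map e.symm.toRingHom = H := by
    rw [Matrix.map_map]
    ext i j
    simp only [Matrix.map_apply, Function.comp_apply]
    exact e.symm_apply_apply (H i j)
  have h2 : (1 : Matrix n n (w.adicCompletion K × w.adicCompletion K)).map e.symm.toRingHom = 1 :=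
    Matrix.map_one _ (map_zero _) (map_one _)
  rwa [h1, h2] at hback

include w w' hw hθ hy hne hsq in
/-- Any two hermitian matrices with unit determinant over `K⁺_v ⊗ K` are congruent at a split place. -/
theorem isCongruent_of_isHermitian {n : Type*} [Fintype n] [DecidableEq n]
    {H H' : Matrix n n ((v.adicCompletion (maximalRealSubfield K)) ⊗[maximalRealSubfield K] K)}
    (hH : letI := tensorStarRing K v; H.IsHermitian) (hH' : letI := tensorStarRing K v; H'.IsHermitian)
    (hdet : IsUnit H.det) (hdet' : IsUnit H'.det) :
    letI := tensorStarRing K v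
    IsCongruent H H' := by
  letI := tensorStarRing K v
  exact (exists_isCongruent_one K v w w' hw hθ hy hne hsq H hH hdet).trans
    (exists_isCongruent_one K v w w' hw hθ hy hne hsq H' hH' hdet').symm

end Split

end Summit.Ventures.HodgeRepro2.T5FinitePlaceSplitClassification
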